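import Summits.QuantumFields.YangMills.Theorems.BalabanUVNodesN15KingModelAnalyticDeterminantFlat
import Summits.QuantumFields.YangMills.Theorems.BalabanUVNodesN15KingModelAnalyticDeterminantDiamagnetic
import Summits.QuantumFields.YangMills.Theorems.BalabanUVNodesN15KingModelAnalyticDeterminantConcavity
import HarnessLib

/-!
# BalabanUVNodes ∕ N15 — THE KING-MODEL RUNG (PART Ϭ-j): THE GAUSSIAN NORMALISATIONS AT EVERY BACKGROUND — GAUGE INVARIANCE, THE PACKAGE, AND WHAT THE CURVED CASE ADDS —
# all three one-level normalisations (`det A₀(U)`, `det(−cΔ_U+m²)`, `det Δ_eff(U)`) are invariant under unitary lattice gauge transformations (`A₀(U^g) = D_gA₀(U)D_g^*`, PART Ϥ-d, and PART Ϭ-a's identity);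
# the PACKAGE of PART Ϭ by name (identity · sharp window · King floor · block-term sandwich · asymptotic diamagnetism · response sandwich · flat closed form); and the honest ledger «what the curved
# case adds»: at `U ≡ 1` King's closed forms (PARTS Ε-q∕Ε-n∕Ε-p), at a curved `U` the SAME identity but only WINDOWS of width `N·ln(1+a∕m²)` around the closed form, a non-negative fine
# (diamagnetic) shift and a block-field shift of either sign bounded by `N·ln(1+a∕m²)`
# (Track A, DAG node N15 = NE2; FAN-OUT v1.1 §N15 s3 «KING-MODEL RUNG … + what the curved case adds»; count-neutral)

HONEST FRAMING.  Count-neutral (cell `pub-ymgap`, seat `pub-ymgap-dag-n15-e` g53; `--supports stmt-QuantumFields-27247 --as helper` = K3ᴬ, KEY MAP v3).  King's one-level comparison model in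
King's scaling `c = L²`, `L ≥ 1`, `a, m² > 0`, unitary backgrounds, any `RCLike` fibre (nonempty); by-name packaging of PARTS Ϭ-a … Ϭ-i — no new estimate; the Lipschitz∕window statements of
PARTS Ϭ-c∕Ϭ-d (`𝕜 = ℂ`) are cited, not re-packaged.  NOT Bałaban's multi-level `Z_k`; NOT King's loop expansion (3.97)–(3.98); NOT a node discharge (N15 of record untouched); nothing
continuum ∕ ℝ⁴ ∕ OS ∕ Clay.

THE RESULTS (unitary `U`, unitary gauge `g`; `N = |T₁|·|n|`):
* §1 ★★ `det_fullOpU_kingGaugeAct` (`det A₀(U^g) = det A₀(U)`), ★★★ **`re_det_effLapU_kingGaugeAct`** (`det Δ_eff(U^g) = det Δ_eff(U)` — through PART Ϭ-a's identity, no covariance lemma for `Δ_eff` needed),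
  ★★ `king_logZ_kingGaugeAct` (King's `ln[Z(U)Z(1)⁻¹]` is gauge invariant), ★★ `log_gaussNorm_effLapU_kingGaugeAct` (`𝕜 = ℝ`).
* §2 ★★★★ **`king_gaussian_normalisations_package`** (seven conjuncts by name: Ϭ-a identity · Ϭ-b sharp window · Ϭ-e King floor · Ϭ-g block-term sandwich · Ϭ-g asymptotic diamagnetism · Ϭ-f response
  sandwich (against the flat background) · Ϭ-i flat closed form).
* §3 ★★★ **`king_normalisations_what_the_curved_case_adds`** (the honest ledger as one conjunction: same identity; `|ln det Δ_eff(U) − |n|Σ_q ln effSym(q)| ≤ N·ln(1+a∕m²)`; `0 ≤` fine shift;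
  `−N·ln(1+a∕m²) ≤` King's `ln Z` shift; gauge invariance).
PRIOR TREE ART (by name): Ϥ-d (`fullOpU_kingGaugeAct`), Ͱ-a (`det_covLapF_kingGaugeAct`, `kingGaugeMat_mul_conjTranspose_self`, `kingGaugeAct_mem_unitaryGroup`), Ϭ-a (`det_effLapU_mul_det_fullOpU`,
`re_det_effLapU_mul_re_det_fullOpU`, `re_det_fullOpU_pos`, `king_logZ_split`), Ϭ-b (`pow_le_re_det_effLapU`, `re_det_effLapU_le_pow`, `log_gaussNorm_effLapU`), Ϭ-e (`pow_le_re_det_effLapU_king`), Ϭ-f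
(`king_first_order_response_sandwich`), Ϭ-g (`log_re_det_fullOpU_ge_covLapF`, `log_re_det_fullOpU_le_covLapF_add`, `king_logZ_sub_flat_ge`, `log_re_det_covLapF_sub_flat_nonneg`, `flat_mem_unitaryGroup`), Ϭ-i
(`re_det_effLapU_flat_eq_prod_effSym`, `abs_log_re_det_effLapU_sub_closedForm_le`).  Dedup (rg at filing): basename 0 files; needles
`re_det_effLapU_kingGaugeAct|det_fullOpU_kingGaugeAct|king_gaussian_normalisations_package|king_normalisations_what_the_curved_case_adds|king_logZ_kingGaugeAct` 0 tree files.
Locators: [King1986] (2.4)–(2.6) p.652, (2.13)–(2.16) p.653, (3.89)–(3.90) pp.668–669, (3.94)–(3.96) p.669, (4.33) p.674, (4.44)–(4.45) p.675; [Balaban1985BackgroundPropagators] (3.31)–(3.34) pp.395–396;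
[Balaban1982Higgs2] (3.37)–(3.38) p.591.  0 `sorry`, 0 `def`.
-/

noncomputable section
open scoped BigOperators ComplexConjugate ComplexOrder Matrix.Norms.L2Operator
open Finset Matrix

namespace Summit.QuantumFields.YangMills.BalabanUVNodes.N15KingModelRung.Analytic

open Literature.MathematicalPhysics.QuantumFieldTheory.Balaban1983to89.B5Prop11Plancherel (Tor fine)
open Literature.MathematicalPhysics.QuantumFieldTheory.King1986.Torus (lapF effLaplacian effSym)
open Summit.QuantumFields.YangMills.BalabanUVNodes.N15KingModelRung.Covariant (covLapF kingGaugeAct kingGaugeMat det_covLapF_kingGaugeAct kingGaugeMat_mul_conjTranspose_self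
  kingGaugeAct_mem_unitaryGroup)
open Summit.QuantumFields.YangMills.BalabanUVNodes.N15KingModelRung.CovariantBlock (BlockTree fullOpU effLapU fullOpU_kingGaugeAct)
open Summit.QuantumFields.YangMills.BalabanUVNodes.N15KingModelRung.FreeField (gaussNorm)

variable {d : ℕ} {L : ℕ} [NeZero L] (T : BlockTree d L) (M : Fin (d + 1) → ℕ) [hM : ∀ μ, NeZero (M μ)]

/-! ## §1 Gauge invariance of the three normalisations -/

section Gauge

variable {𝕜 : Type*} [RCLike 𝕜] {n : Type*} [Fintype n] [DecidableEq n]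
variable {a c m2 : ℝ} {g : Tor (fine L M) → Matrix n n 𝕜} (hg : ∀ x, g x ∈ Matrix.unitaryGroup n 𝕜)
include hg

/-- ★★ **`det A₀(U^g) = det A₀(U)`** for every unitary lattice gauge transformation (`A₀(U^g) = D_gA₀(U)D_g^*`, PART Ϥ-d). [cite: Balaban1985BackgroundPropagators, (3.34) p.396, (3.31)–(3.32) p.395; King1986, (2.13) p.653] -/
theorem det_fullOpU_kingGaugeAct (a c m2 : ℝ) (U : Tor (fine L M) × Fin (d + 1) → Matrix n n 𝕜) :
    (fullOpU T M a c m2 (kingGaugeAct (fine L M) g U)).det = (fullOpU T M a c m2 U).det := by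
  rw [fullOpU_kingGaugeAct T M a c m2 hg U, Matrix.det_mul, Matrix.det_mul, mul_comm ((kingGaugeMat (fine L M) g).det), mul_assoc, ← Matrix.det_mul,
    kingGaugeMat_mul_conjTranspose_self (fine L M) hg, Matrix.det_one, mul_one]

variable (ha : 0 < a) (hc : 0 ≤ c) (hm : 0 < m2) {U : Tor (fine L M) × Fin (d + 1) → Matrix n n 𝕜} (hU : ∀ bd, U bd ∈ Matrix.unitaryGroup n 𝕜)
include ha hc hm hU

/-- ★★★ **THE BLOCK-FIELD NORMALISATION IS GAUGE INVARIANT**: `det Δ_eff(U^g) = det Δ_eff(U)` — through PART Ϭ-a's identity `det Δ_eff·det A₀ = a^{N}·det B` and the invariance of `det A₀`, `det B`.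
[cite: King1986, (2.14) p.653, (3.89)–(3.90) pp.668–669; Balaban1985BackgroundPropagators, (3.34) p.396] -/
theorem re_det_effLapU_kingGaugeAct :
    RCLike.re (effLapU T M a c m2 (kingGaugeAct (fine L M) g U)).det = RCLike.re (effLapU T M a c m2 U).det := by
  have hUg : ∀ bd, kingGaugeAct (fine L M) g U bd ∈ Matrix.unitaryGroup n 𝕜 := kingGaugeAct_mem_unitaryGroup (fine L M) hg hU
  have h1 := re_det_effLapU_mul_re_det_fullOpU T M ha hc hm hUg
  have h2 := re_det_effLapU_mul_re_det_fullOpU T M ha hc hm hU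
  rw [det_fullOpU_kingGaugeAct T M hg, det_covLapF_kingGaugeAct (fine L M) c m2 hg U, ← h2] at h1
  exact mul_right_cancel₀ (re_det_fullOpU_pos T M hc hm hU ha.le).ne' h1

omit ha hc hm hU in
/-- ★★ **KING's `ln[Z(U)Z(1)⁻¹]` IS GAUGE INVARIANT**. [cite: King1986, (3.90) p.669; Balaban1985BackgroundPropagators, (3.34) p.396] -/
theorem king_logZ_kingGaugeAct :
    Real.log (RCLike.re (fullOpU T M a c m2 (kingGaugeAct (fine L M) g U)).det) - Real.log (RCLike.re (fullOpU T M a c m2 (fun _ => (1 : Matrix n n 𝕜))).det)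
      = Real.log (RCLike.re (fullOpU T M a c m2 U).det) - Real.log (RCLike.re (fullOpU T M a c m2 (fun _ => (1 : Matrix n n 𝕜))).det) := by
  rw [det_fullOpU_kingGaugeAct T M hg]

end Gauge

section GaugeReal

variable {n : Type*} [Fintype n] [DecidableEq n] [Nonempty n]
variable {a c m2 : ℝ} (ha : 0 < a) (hc : 0 ≤ c) (hm : 0 < m2) {g : Tor (fine L M) → Matrix n n ℝ} (hg : ∀ x, g x ∈ Matrix.unitaryGroup n ℝ)
variable {U : Tor (fine L M) × Fin (d + 1) → Matrix n n ℝ} (hU : ∀ bd, U bd ∈ Matrix.unitaryGroup n ℝ)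
include ha hc hm hg hU

/-- ★★ **KING's `E₀` OF THE BLOCK FIELD IS GAUGE INVARIANT** (`𝕜 = ℝ`): `ln 𝒩(Δ_eff(U^g)) = ln 𝒩(Δ_eff(U))`. [cite: King1986, (2.6) p.652, (3.89) p.668; Balaban1985BackgroundPropagators, (3.34) p.396] -/
theorem log_gaussNorm_effLapU_kingGaugeAct :
    Real.log (gaussNorm (effLapU T M a c m2 (kingGaugeAct (fine L M) g U))) = Real.log (gaussNorm (effLapU T M a c m2 U)) := by
  have hUg : ∀ bd, kingGaugeAct (fine L M) g U bd ∈ Matrix.unitaryGroup n ℝ := kingGaugeAct_mem_unitaryGroup (fine L M) hg hU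
  rw [log_gaussNorm_effLapU T M ha hc hm hUg, log_gaussNorm_effLapU T M ha hc hm hU]
  have h := re_det_effLapU_kingGaugeAct T M hg ha hc hm hU
  simp only [RCLike.re_to_real] at h
  rw [h]

end GaugeReal

/-! ## §2 The package -/

section Package

variable {𝕜 : Type*} [RCLike 𝕜] {n : Type*} [Fintype n] [DecidableEq n]
variable (hL : 1 ≤ L) {a m2 : ℝ} (ha : 0 < a) (hm : 0 < m2) {U : Tor (fine L M) × Fin (d + 1) → Matrix n n 𝕜} (hU : ∀ bd, U bd ∈ Matrix.unitaryGroup n 𝕜)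
include hL ha hm hU

/-- ★★★★ **THE GAUSSIAN NORMALISATIONS AT EVERY BACKGROUND — THE PACKAGE** (King's scaling `c = L²`, `L ≥ 1`, `a, m² > 0`, unitary `U`, any tree contour system, any fibre):
(1) `det Δ_eff(U)·det A₀(U) = a^{N}·det(−cΔ_U+m²)` (Ϭ-a); (2) `(a⁻¹+m⁻²)^{−N} ≤ det Δ_eff(U) ≤ a^{N}` (Ϭ-b); (3) `(|T₁|∕tr (Δ^{(K)})⁻¹)^{N} ≤ det Δ_eff(U)` (Ϭ-e); (4) `ln det B(U) ≤ ln det A₀(U) ≤ ln det B(U) + N·ln(1+a∕m²)` (Ϭ-g);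
(5) `ln det A₀(U) − ln det A₀(1) ≥ −N·ln(1+a∕m²)` (Ϭ-g); (6) `Re tr(C(U)E) ≤ ln det Δ_eff(U) − ln det Δ_eff(1) ≤ Re tr(C(1)E)`, `E = Δ_eff(U) − Δ_eff(1)` (Ϭ-f); (7) `det Δ_eff(1) = (Π_q effSym(q))^{|n|}` (Ϭ-i).
[cite: King1986, (2.4)–(2.6) p.652, (2.13)–(2.16) p.653, (3.89)–(3.90) pp.668–669, (3.94)–(3.96) p.669, (4.33) p.674, (4.44)–(4.45) p.675; Balaban1982Higgs2, (3.37)–(3.38) p.591] -/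
theorem king_gaussian_normalisations_package [Nonempty n] :
    (effLapU T M a ((L : ℝ) ^ 2) m2 U).det * (fullOpU T M a ((L : ℝ) ^ 2) m2 U).det = (a : 𝕜) ^ Fintype.card (Tor M × n) * (covLapF (fine L M) ((L : ℝ) ^ 2) m2 U).det
    ∧ ((a⁻¹ + m2⁻¹)⁻¹ ^ Fintype.card (Tor M × n) ≤ RCLike.re (effLapU T M a ((L : ℝ) ^ 2) m2 U).det
        ∧ RCLike.re (effLapU T M a ((L : ℝ) ^ 2) m2 U).det ≤ a ^ Fintype.card (Tor M × n))
    ∧ (Fintype.card (Tor M) / ((effLaplacian L M a ((L : ℝ) ^ 2) m2)⁻¹).trace) ^ Fintype.card (Tor M × n) ≤ RCLike.re (effLapU T M a ((L : ℝ) ^ 2) m2 U).det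
    ∧ (Real.log (RCLike.re (covLapF (fine L M) ((L : ℝ) ^ 2) m2 U).det) ≤ Real.log (RCLike.re (fullOpU T M a ((L : ℝ) ^ 2) m2 U).det)
        ∧ Real.log (RCLike.re (fullOpU T M a ((L : ℝ) ^ 2) m2 U).det) ≤ Real.log (RCLike.re (covLapF (fine L M) ((L : ℝ) ^ 2) m2 U).det) + Fintype.card (Tor M × n) * Real.log (1 + a / m2))
    ∧ -(Fintype.card (Tor M × n) * Real.log (1 + a / m2))
        ≤ Real.log (RCLike.re (fullOpU T M a ((L : ℝ) ^ 2) m2 U).det) - Real.log (RCLike.re (fullOpU T M a ((L : ℝ) ^ 2) m2 (fun _ => (1 : Matrix n n 𝕜))).det)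
    ∧ (RCLike.re (((effLapU T M a ((L : ℝ) ^ 2) m2 U)⁻¹ * (effLapU T M a ((L : ℝ) ^ 2) m2 U - effLapU T M a ((L : ℝ) ^ 2) m2 (fun _ => (1 : Matrix n n 𝕜)))).trace)
          ≤ Real.log (RCLike.re (effLapU T M a ((L : ℝ) ^ 2) m2 U).det) - Real.log (RCLike.re (effLapU T M a ((L : ℝ) ^ 2) m2 (fun _ => (1 : Matrix n n 𝕜))).det)
        ∧ Real.log (RCLike.re (effLapU T M a ((L : ℝ) ^ 2) m2 U).det) - Real.log (RCLike.re (effLapU T M a ((L : ℝ) ^ 2) m2 (fun _ => (1 : Matrix n n 𝕜))).det)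
          ≤ RCLike.re (((effLapU T M a ((L : ℝ) ^ 2) m2 (fun _ => (1 : Matrix n n 𝕜)))⁻¹ * (effLapU T M a ((L : ℝ) ^ 2) m2 U - effLapU T M a ((L : ℝ) ^ 2) m2 (fun _ => (1 : Matrix n n 𝕜)))).trace))
    ∧ RCLike.re (effLapU T M a ((L : ℝ) ^ 2) m2 (fun _ => (1 : Matrix n n 𝕜))).det = (∏ q : Tor M, effSym L M a ((L : ℝ) ^ 2) m2 q) ^ Fintype.card n := by
  have hc : (0 : ℝ) ≤ (L : ℝ) ^ 2 := by positivity
  have h1 := flat_mem_unitaryGroup (L := L) (d := d) M (n := n) (𝕜 := 𝕜)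
  exact ⟨det_effLapU_mul_det_fullOpU T M ha hc hm hU,
    ⟨pow_le_re_det_effLapU T M ha hc hm hU, re_det_effLapU_le_pow T M ha hc hm hU⟩,
    pow_le_re_det_effLapU_king T M hL ha hm hU,
    ⟨log_re_det_fullOpU_ge_covLapF T M ha hc hm hU, log_re_det_fullOpU_le_covLapF_add T M ha hc hm hU⟩,
    king_logZ_sub_flat_ge T M ha hc hm hU,
    king_first_order_response_sandwich T M ha hc hm hU h1,
    re_det_effLapU_flat_eq_prod_effSym T M hL ha hm⟩

/-! ## §3 What the curved case adds -/

/-- ★★★ **WHAT THE CURVED CASE ADDS** (the honest ledger): at the flat background King's CLOSED FORMS (PARTS Ε-q ∕ Ε-n ∕ Ε-p); at a curved unitary `U` (i) the SAME RG determinant identity,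
(ii) NO closed form but a window: `|ln det Δ_eff(U) − |n|·Σ_q ln effSym(q)| ≤ N·ln(1+a∕m²)`, (iii) the minimally coupled normalisation only INCREASES (diamagnetism, `0 ≤ ln det B(U) − ln det B(1)`),
(iv) King's `ln[Z(U)Z(1)⁻¹]` may decrease but by at most `N·ln(1+a∕m²)` (block-extensive, `O(η^{d+1})` per fine site), (v) everything is gauge invariant.
[cite: King1986, (2.13)–(2.16) p.653, (3.89)–(3.90) pp.668–669, (4.33) p.674; Balaban1982Higgs2, (3.37)–(3.38) p.591; Balaban1985BackgroundPropagators, (3.34) p.396] -/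
theorem king_normalisations_what_the_curved_case_adds {g : Tor (fine L M) → Matrix n n 𝕜} (hg : ∀ x, g x ∈ Matrix.unitaryGroup n 𝕜) :
    (effLapU T M a ((L : ℝ) ^ 2) m2 U).det * (fullOpU T M a ((L : ℝ) ^ 2) m2 U).det = (a : 𝕜) ^ Fintype.card (Tor M × n) * (covLapF (fine L M) ((L : ℝ) ^ 2) m2 U).det
    ∧ |Real.log (RCLike.re (effLapU T M a ((L : ℝ) ^ 2) m2 U).det) - Fintype.card n * ∑ q : Tor M, Real.log (effSym L M a ((L : ℝ) ^ 2) m2 q)|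
        ≤ Fintype.card (Tor M × n) * Real.log (1 + a / m2)
    ∧ 0 ≤ Real.log (RCLike.re (covLapF (fine L M) ((L : ℝ) ^ 2) m2 U).det) - Real.log (RCLike.re (covLapF (fine L M) ((L : ℝ) ^ 2) m2 (fun _ : Tor (fine L M) × Fin (d + 1) => (1 : Matrix n n 𝕜))).det)
    ∧ -(Fintype.card (Tor M × n) * Real.log (1 + a / m2))
        ≤ Real.log (RCLike.re (fullOpU T M a ((L : ℝ) ^ 2) m2 U).det) - Real.log (RCLike.re (fullOpU T M a ((L : ℝ) ^ 2) m2 (fun _ => (1 : Matrix n n 𝕜))).det)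
    ∧ RCLike.re (effLapU T M a ((L : ℝ) ^ 2) m2 (kingGaugeAct (fine L M) g U)).det = RCLike.re (effLapU T M a ((L : ℝ) ^ 2) m2 U).det := by
  have hc : (0 : ℝ) ≤ (L : ℝ) ^ 2 := by positivity
  exact ⟨det_effLapU_mul_det_fullOpU T M ha hc hm hU, abs_log_re_det_effLapU_sub_closedForm_le T M hL ha hm hU, log_re_det_covLapF_sub_flat_nonneg M hc hm hU,
    king_logZ_sub_flat_ge T M ha hc hm hU, re_det_effLapU_kingGaugeAct T M hg ha hc hm hU⟩

end Package

end Summit.QuantumFields.YangMills.BalabanUVNodes.N15KingModelRung.Analytic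

end
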